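import Summits.HodgeConjecture.HodgeConjecture.Theorems.Ring2AbelianAllAndreFibreClassExtremeDegrees
import Literature.AlgebraicGeometry.HodgeTheory.InvariantClassesFromTotalSpace
import Literature.AlgebraicGeometry.HodgeTheory.RelativeHyperplaneClassHodgeRiemann
import Literature.AlgebraicGeometry.HodgeTheory.HyperplaneClassHardLefschetzPullback
import Literature.AlgebraicGeometry.HodgeTheory.HyperplaneClassRational
import HarnessLib

/-!
# Ring 2 · sub-cell AbelianAll (ALL ABELIAN VARIETIES), André axis, part XII-a — the image of
# restriction to a fibre is stable under the PRIMITIVE PARTS of the Lefschetz decomposition, from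
# the named fact "invariant classes come from the total space" (Deligne 1968 / Voisin II Thm. 4.18)

HONEST FRAMING (page 1, verbatim): **research route, not a corollary; conditional on HC_CM plus one named
minimal statement.** Cell line: research route conditional on HC_CM; not a corollary; Q11.4-sentence-2
already refuted in dim ≥ 3. Nothing in this file proves a case of the Hodge conjecture. Seat
`pub-hodge-ring2-ab-andre-2`, gen 4; owed item o9 of RING2-MAP §AbelianAll AA2.22/AA2.23 ("a carrier / fact for κ,
so that K[κ] becomes K[fact]"). This is the first half of the derivation of the supply node (κ) — Deligne's
invariant-cycle kernel identity `j_{t*} j_t^* W = 0 ⟹ j_t^* W = 0` (parts X-b/X-c) — from ONE NAMED FACT ALREADY IN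
THE TREE, `deligne1968_invariantClass_fromTotalSpace` (Voisin II Thm. 4.18 / Deligne 1968 (2.1)+(2.6.3):
`Hᵏ(𝒳) → Hᵏ(X_t)^{inv}` is onto, on the étalé carriers `FiberClass f k` of `HodgeTheory/HodgeLocus`), and
tree THEOREMS only (hard Lefschetz for restricted hyperplane classes, the Lefschetz decomposition, Ehresmann's
cohomological local triviality). Part XII-b concludes with the polarisation (Hodge–Riemann) of the fibre.

## Content (everything below is a theorem; `h418` = the named fact, a displayed hypothesis)

* §1 LEFSCHETZ ALGEBRA on `H•(Y; R)` (any space, any commutative ring): additive maps `T : H•(Y₁) → H•(Y₂)`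
  intertwining two Lefschetz operators commute with the Lefschetz iterates, preserve primitive classes and
  COMMUTE WITH THE PRIMITIVE PARTS `ξ_P` of the two Lefschetz decompositions
  (`map_primitivePart_of_semiconj`; the tree's `map_primitivePart_of_commute` is the case `Y₁ = Y₂`); the
  identity **`(L^{n-a} u) ∪ ξ_P x = (L^{n-a-t} u) ∪ x`** in `H^{2n}` for `u` primitive of degree `a`,
  `P = (a, t)` (`cupProduct_lefschetzPowTo_primitivePart_eq`: the other Lefschetz components of `x` are
  orthogonal to `u`, Voisin I Lemma 6.29 / proof of Thm. 6.32) — the bridge between the polarisation form and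
  the plain cup product used in part XII-b.
* §2 ONE GLOBAL CLASS POLARISING EVERY FIBRE (`exists_globalKaehlerClass`): for a compact pencil
  `f : 𝒳 ⟶ S` of abelian `d`-folds, `d ≥ 1`, and a point `t`, a class `K ∈ H²(𝒳(ℂ); ℂ)` — the pull-back of a
  generator of `H²(ℙᴺ(ℂ); ℂ)` along `𝒳 ↪ ℙᴺ` — whose restriction to `X_t` is the rational Kähler class of a
  Kähler–rational datum of `X_t` (tree: `exists_kaehlerRationalDatum_eq_map`) and whose restriction to EVERY
  fibre has the hard Lefschetz property (tree: `hasHardLefschetzProperty_map_of_forall_eq_smul`).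
* §3 FLAT PRIMITIVE PARTS (`continuous_primitivePartSection`): the section `s ↦ (s, ξ_P^{(s)}(A|_{X_s}))` of the
  étalé space `FiberClass f a` is CONTINUOUS (over an Ehresmann tube it is the tube section of
  `r_{s₀}⁻¹ ξ_P^{(s₀)}(A|_{X_{s₀}})`: the transports `r_s ∘ r_{s₀}⁻¹` intertwine the primitive parts, §1).
* §4 **THE STABILITY** (`exists_primitivePart_map_fiberι_eq`): granted `h418`, for every global `A` and
  every index `P` there is a global `B ∈ Hᵃ(𝒳(ℂ); ℂ)` with `ξ_P^{(t)}(A|_{X_t}) = B|_{X_t}` — `Im(j_t^*)` is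
  stable under the primitive projections of `(X_t, K|_{X_t})` (in print: the invariants form a sub-VHS stable
  under the relative Lefschetz `sl₂`). References: VoisinHodgeII2003 (Thm. 4.15, Lemma 4.17, Thm. 4.18, §3.1.2);
  Deligne1968 ((2.1), (2.6.3)); VoisinHodgeI2002 (Cor. 6.26, Lemma 6.29, Thm. 6.32, §7.1.2, Thm. 9.3).
-/

noncomputable section

set_option linter.dupNamespace false

namespace Summit.HodgeConjecture.HodgeConjecture.Ring2.AbelianAll

open CategoryTheory AlgebraicGeometry MonoidalCategory
open _root_.Topology _root_.Filter
open Literature.AlgebraicGeometry Literature.AlgebraicGeometry.Motives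
open Literature.AlgebraicGeometry.HodgeTheory
open Literature.AlgebraicTopology.SingularHomology (singularCohomology cupProduct cupProduct_map)
open Literature.Geometry.Kaehler (lefschetzOperator HasHardLefschetzProperty)
open Summit.HodgeConjecture.HodgeConjecture
universe u v

/-! ## §1 Lefschetz algebra: maps intertwining two Lefschetz operators; the cup-product bridge -/

section LefschetzAlgebra

variable {Y₁ Y₂ : Type u} [TopologicalSpace Y₁] [TopologicalSpace Y₂] {R : Type v} [CommRing R]
variable {κ₁ : singularCohomology R R Y₁ 2} {κ₂ : singularCohomology R R Y₂ 2} {n : ℕ}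

/-- **Additive maps intertwining the Lefschetz operators of `(Y₁, κ₁)` and `(Y₂, κ₂)` intertwine their
iterates** (`T (L₁ʲ x) = L₂ʲ (T x)`; the two-space form of the tree's `map_lefschetzPowTo_of_commute`).
[cite: VoisinHodgeI2002, §6.2.3] -/
theorem map_lefschetzPowTo_of_semiconj
    (T : ∀ a, singularCohomology R R Y₁ a →+ singularCohomology R R Y₂ a)
    (hT : ∀ (k l : ℕ) (h : 2 + k = l) (x : singularCohomology R R Y₁ k),
      T l (lefschetzOperator κ₁ h x) = lefschetzOperator κ₂ h (T k x)) :
    ∀ (t a m : ℕ) (h : a + 2 * t = m) (x : singularCohomology R R Y₁ a),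
      T m (lefschetzPowTo κ₁ t a m h x) = lefschetzPowTo κ₂ t a m h (T a x)
  | 0, a, m, h, x => by
    subst h
    rfl
  | t + 1, a, m, h, x => by
    rw [lefschetzPowTo_succ_apply κ₁ t a (a + 2 * t) m rfl h (by omega),
      lefschetzPowTo_succ_apply κ₂ t a (a + 2 * t) m rfl h (by omega), hT,
      map_lefschetzPowTo_of_semiconj T hT t a (a + 2 * t) rfl x]

/-- Such maps carry `κ₁`-primitive classes to `κ₂`-primitive classes (same dimension `n`).
[cite: VoisinHodgeI2002, §6.2.3 Def. 6.24] -/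
theorem map_mem_primitiveClasses_of_semiconj
    (T : ∀ a, singularCohomology R R Y₁ a →+ singularCohomology R R Y₂ a)
    (hT : ∀ (k l : ℕ) (h : 2 + k = l) (x : singularCohomology R R Y₁ k),
      T l (lefschetzOperator κ₁ h x) = lefschetzOperator κ₂ h (T k x))
    {a : ℕ} {x : singularCohomology R R Y₁ a} (hx : x ∈ primitiveClasses κ₁ n a) :
    T a x ∈ primitiveClasses κ₂ n a :=
  ⟨fun ha ↦ by rw [hx.1 ha, map_zero],
    fun r m h hr ↦ by rw [← map_lefschetzPowTo_of_semiconj T hT r a m h x, hx.2 r m h hr, map_zero]⟩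

/-- **Such maps commute with the primitive parts of the two Lefschetz decompositions**:
`T (ξ_P x) = ξ_P (T x)` (uniqueness of the Lefschetz decomposition of `T x`, Voisin I Cor. 6.26).
[cite: VoisinHodgeI2002, §6.2.3 Cor. 6.26] -/
theorem map_primitivePart_of_semiconj (hL₁ : HasHardLefschetzProperty κ₁ n)
    (hvan₁ : ∀ m, 2 * n < m → Subsingleton (singularCohomology R R Y₁ m))
    (hL₂ : HasHardLefschetzProperty κ₂ n)
    (hvan₂ : ∀ m, 2 * n < m → Subsingleton (singularCohomology R R Y₂ m))
    (T : ∀ a, singularCohomology R R Y₁ a →+ singularCohomology R R Y₂ a)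
    (hT : ∀ (k l : ℕ) (h : 2 + k = l) (x : singularCohomology R R Y₁ k),
      T l (lefschetzOperator κ₁ h x) = lefschetzOperator κ₂ h (T k x))
    {i : ℕ} (p : {p : ℕ × ℕ // p.1 + 2 * p.2 = i}) (x : singularCohomology R R Y₁ i) :
    T p.1.1 (primitivePart κ₁ n hL₁ hvan₁ p x) = primitivePart κ₂ n hL₂ hvan₂ p (T i x) := by
  classical
  symm
  refine primitivePart_eq_of_sum_eq hL₂ hvan₂
    (y := fun q ↦ T q.1.1 (primitivePart κ₁ n hL₁ hvan₁ q x))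
    (fun q ↦ map_mem_primitiveClasses_of_semiconj T hT (primitivePart_mem hL₁ hvan₁ q x))
    (fun q hq ↦ by rw [primitivePart_of_lt hL₁ hvan₁ q hq, LinearMap.zero_apply, map_zero]) ?_ p
  calc ∑ q : {p : ℕ × ℕ // p.1 + 2 * p.2 = i},
        lefschetzPowTo κ₂ q.1.2 q.1.1 i q.2 (T q.1.1 (primitivePart κ₁ n hL₁ hvan₁ q x))
      = ∑ q : {p : ℕ × ℕ // p.1 + 2 * p.2 = i},
          T i (lefschetzPowTo κ₁ q.1.2 q.1.1 i q.2 (primitivePart κ₁ n hL₁ hvan₁ q x)) :=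
        Finset.sum_congr rfl fun q _ ↦ (map_lefschetzPowTo_of_semiconj T hT _ _ _ _ _).symm
    _ = T i (∑ q : {p : ℕ × ℕ // p.1 + 2 * p.2 = i},
          lefschetzPowTo κ₁ q.1.2 q.1.1 i q.2 (primitivePart κ₁ n hL₁ hvan₁ q x)) := (map_sum (T i) _ _).symm
    _ = T i x := by rw [sum_lefschetzPowTo_primitivePart hL₁ hvan₁ x]

/-- The primitive parts depend on the class `κ` only (not on the chosen proofs): rewriting along an
equality of classes. [folklore] -/
theorem primitivePart_congr {Y : Type u} [TopologicalSpace Y] {κ κ' : singularCohomology R R Y 2}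
    (e : κ = κ') (hL : HasHardLefschetzProperty κ n) (hL' : HasHardLefschetzProperty κ' n)
    (hvan : ∀ m, 2 * n < m → Subsingleton (singularCohomology R R Y m))
    {i : ℕ} (p : {p : ℕ × ℕ // p.1 + 2 * p.2 = i}) (x : singularCohomology R R Y i) :
    primitivePart κ n hL hvan p x = primitivePart κ' n hL' hvan p x := by
  subst e
  rfl

variable {Y : Type u} [TopologicalSpace Y] (κ : singularCohomology R R Y 2)

/-- `(Lⁱ u) ∪ (Lʲ v) = (L^{i+j} u) ∪ v`: all powers of `κ` may be moved onto the FIRST factor (companion of the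
tree's `cupProduct_lefschetzPowTo_lefschetzPowTo`, which moves them onto the second).
[cite: HatcherAT2002, §3.2 p. 211 and Thm. 3.11] -/
theorem cupProduct_lefschetzPowTo_lefschetzPowTo_left (i j : ℕ) {p k a b s c : ℕ} (ha : p + 2 * i = a)
    (hb : k + 2 * j = b) (hs : a + b = s) (hc : p + 2 * (i + j) = c) (hs' : c + k = s)
    (u : singularCohomology R R Y p) (v : singularCohomology R R Y k) :
    cupProduct hs (lefschetzPowTo κ i p a ha u) (lefschetzPowTo κ j k b hb v) =
      cupProduct hs' (lefschetzPowTo κ (i + j) p c hc u) v := by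
  rw [cupProduct_lefschetzPowTo_right κ j hb hs (rfl : a + k = a + k) (by omega)
      (lefschetzPowTo κ i p a ha u) v,
    cupProduct_lefschetzPowTo_left κ i ha rfl (rfl : p + k = p + k) (by omega) u v,
    lefschetzPowTo_lefschetzPowTo κ j (by omega) (by omega) (by omega),
    cupProduct_lefschetzPowTo_left κ (i + j) hc hs' rfl (by omega) u v]

/-- **The cup-product bridge** (Voisin I Lemma 6.29, proof of Thm. 6.32): for `u ∈ Pᵃ` primitive, a
Lefschetz index `P = (a, t)` of degree `i = a + 2t` with `a + t ≤ n`, and ANY `x ∈ Hⁱ(Y; R)`,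
`(L^{n-a} u) ∪ ξ_P x = (L^{n-a-t} u) ∪ x` in `H^{2n}(Y; R)`: in the Lefschetz decomposition
`x = ∑_{P'} L^{t'} ξ_{P'} x` the components with `P' ≠ P` (primitive degree `a' ≠ a`) are killed, after moving
all powers of `κ` onto the factor of larger primitive degree, by `L^{n-a+1} Pᵃ = 0`. The primitive part of
`x` of index `P` is thereby read off by a plain cup product. [cite: VoisinHodgeI2002, §6.2.3 Lemma 6.29 and §6.3.2 Thm. 6.32]
[cite: HatcherAT2002, §3.2 Thm. 3.11] -/
theorem cupProduct_lefschetzPowTo_primitivePart_eq (hL : HasHardLefschetzProperty κ n)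
    (hvan : ∀ m, 2 * n < m → Subsingleton (singularCohomology R R Y m))
    {i : ℕ} (P : {p : ℕ × ℕ // p.1 + 2 * p.2 = i})
    {u : singularCohomology R R Y P.1.1} (hu : u ∈ primitiveClasses κ n P.1.1)
    (x : singularCohomology R R Y i) {s m s' q : ℕ} (hs : P.1.1 + s = n) (hm : P.1.1 + 2 * s = m)
    (h : m + P.1.1 = 2 * n) (hs' : P.1.1 + P.1.2 + s' = n) (hq : P.1.1 + 2 * s' = q) (h' : q + i = 2 * n) :
    cupProduct h (lefschetzPowTo κ s P.1.1 m hm u) (primitivePart κ n hL hvan P x) =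
      cupProduct h' (lefschetzPowTo κ s' P.1.1 q hq u) x := by
  classical
  obtain ⟨⟨a, t⟩, hP⟩ := P
  dsimp only at hu hs hm h hs' hq hm ⊢
  conv_rhs => rw [← sum_lefschetzPowTo_primitivePart hL hvan x]
  rw [map_sum, Finset.sum_eq_single ⟨(a, t), hP⟩]
  · -- the `P`-term: `(L^{s'} u) ∪ (Lᵗ ξ) = (L^{s'+t} u) ∪ ξ = (Lˢ u) ∪ ξ`
    rw [cupProduct_lefschetzPowTo_lefschetzPowTo_left κ s' t hq hP h' (by omega : a + 2 * (s' + t) = m) h u]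
    exact congrArg (fun z ↦ cupProduct h z _) (lefschetzPowTo_congr_exponent κ (by omega) _ _ u)
  · -- the other terms vanish
    rintro ⟨⟨a', t'⟩, hP'⟩ - hne
    have hne' : a' ≠ a := by
      rintro rfl
      obtain rfl : t' = t := by omega
      exact hne rfl
    set v := primitivePart κ n hL hvan ⟨(a', t'), hP'⟩ x with hv
    have hvprim : v ∈ primitiveClasses κ n a' := primitivePart_mem hL hvan ⟨(a', t'), hP'⟩ x
    dsimp only
    rcases lt_or_gt_of_ne hne' with hlt | hgt
    · -- `a' < a`: move the powers onto `u`, of degree `a`: `L^{s'+t'} u = 0`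
      rw [cupProduct_lefschetzPowTo_lefschetzPowTo_left κ s' t' hq hP' h'
          (rfl : a + 2 * (s' + t') = a + 2 * (s' + t')) (by omega) u v,
        lefschetzPowTo_eq_zero_of_mem_primitiveClasses hu _ (by omega), LinearMap.map_zero,
        LinearMap.zero_apply]
    · -- `a' > a`: move the powers onto `v`, of degree `a'`: `L^{s'+t'} v = 0`
      rw [cupProduct_lefschetzPowTo_lefschetzPowTo κ s' t' hq hP' h'
          (rfl : a' + 2 * (s' + t') = a' + 2 * (s' + t')) (by omega) u v,
        lefschetzPowTo_eq_zero_of_mem_primitiveClasses hvprim _ (by omega), LinearMap.map_zero]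
  · intro hP0
    exact absurd (Finset.mem_univ _) hP0

end LefschetzAlgebra

/-! ## §2 One global class polarising every fibre of a compact pencil -/

variable {𝒳 S : SchemeOver ℂ}

/-- `Hᵐ(X_s(ℂ); ℂ) = 0` above twice the fibre dimension (the `hvan` input of the Lefschetz files for the
fibres). [cite: HatcherAT2002, §3.3 (Prop. 3.29)] -/
theorem hvan_fiberOver {d : ℕ} {f : 𝒳 ⟶ S} (hf : IsCompactAbelianPencil f d) (s : ComplexPoints S) :
    ∀ m, 2 * d < m → Subsingleton (complexBetti (fiberOver f s) m) :=
  subsingleton_of_lt (hf.isSmoothProjective_fiberOver s) ℂ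

/-- **A class with the hard Lefschetz property in dimension `d ≥ 1` is non-zero** (on a fibre of a compact
pencil): `Lᵈ : H⁰ → H^{2d}` is onto the non-zero line `H^{2d}(X_t(ℂ); ℂ)` (part XI), and `Lᵈ_0 = 0` for
`d ≥ 1`. [cite: VoisinHodgeI2002, Thm. 6.25] -/
theorem ne_zero_of_hasHardLefschetzProperty_fiberOver {d : ℕ} {f : 𝒳 ⟶ S} (hf : IsCompactAbelianPencil f d)
    (hd : 1 ≤ d) (t : ComplexPoints S) {κ : complexBetti (fiberOver f t) 2}
    (hκ : HasHardLefschetzProperty κ d) : κ ≠ 0 := by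
  rintro rfl
  obtain ⟨x, hx⟩ := exists_fiberGysin_map_fiberι_top_ne_zero hf t
  have hx0 : complexBetti.map (fiberι f t) (2 * d) x ≠ 0 := fun h0 ↦ hx (by rw [h0, map_zero])
  obtain ⟨d', rfl⟩ : ∃ d', d = d' + 1 := ⟨d - 1, by omega⟩
  have hbij := bijective_lefschetzPowTo_of_hasHardLefschetz (0 : complexBetti (fiberOver f t) 2) hκ
    (show 0 + (d' + 1) = d' + 1 by omega) (2 * (d' + 1)) (by omega)
  obtain ⟨y, hy⟩ := hbij.2 (complexBetti.map (fiberι f t) (2 * (d' + 1)) x)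
  apply hx0
  rw [← hy, lefschetzPowTo_succ_apply (0 : complexBetti (fiberOver f t) 2) d' 0 (0 + 2 * d') (2 * (d' + 1)) rfl
      (by omega) (by omega), Literature.Geometry.Kaehler.lefschetzOperator_apply, LinearMap.map_zero,
    LinearMap.zero_apply]

/-- **One global class polarising every fibre.** For a compact pencil `f : 𝒳 ⟶ S` of abelian `d`-folds,
`d ≥ 1`, and a complex point `t`: a class `K ∈ H²(𝒳(ℂ); ℂ)` whose restriction to `X_t` IS the rational Kähler
class `η ⊗ 1` of a Kähler–rational datum `D` of `X_t` (so that `D`'s polarisation form, hard Lefschetz and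
Hodge–Riemann are those of `K|_{X_t}`), and whose restriction to EVERY fibre `X_s` has the hard Lefschetz
property in dimension `d`. Construction (tree theorems only): `𝒳` is projective, `ε : 𝒳 ⟶ ℙᴺ`; each
`X_s ↪ 𝒳 → ℙᴺ` is a closed immersion (`isClosedImmersion_fiberι_comp_left_of_isPreimmersion`); the datum of
`X_t` may be chosen with Kähler class `(j_t ≫ ε)^* c` (`exists_kaehlerRationalDatum_eq_map`); `c ≠ 0`
(`ne_zero_of_hasHardLefschetzProperty_fiberOver`) spans the line `H²(ℙᴺ(ℂ); ℂ)`
(`exists_isRationalClass_forall_eq_smul_projectiveSpace`), so every `(j_s ≫ ε)^* c` has the hard Lefschetz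
property (`hasHardLefschetzProperty_map_of_forall_eq_smul`); `K := ε^* c`.
[cite: VoisinHodgeII2003, §4.2.3 Thm. 4.15] [cite: VoisinHodgeI2002, Thm. 6.25, Thm. 7.10 and §7.1.2] -/
theorem exists_globalKaehlerClass {d : ℕ} {f : 𝒳 ⟶ S} (hf : IsCompactAbelianPencil f d) (hd : 1 ≤ d)
    (t : ComplexPoints S) :
    ∃ (K : complexBetti 𝒳 2) (D : KaehlerRationalDatum d (fiberOver f t)),
      complexBetti.map (fiberι f t) 2 K = D.Hη ∧
        ∀ s : ComplexPoints S, HasHardLefschetzProperty (complexBetti.map (fiberι f s) 2 K) d := by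
  have h𝒳 := hf.isSmoothProjective_total
  obtain ⟨N, ε, hε⟩ := IsQuasiProjectiveOver.exists_isPreimmersion
    (IsQuasiProjectiveOver.of_isProjectiveOver h𝒳.isProjectiveOver)
  haveI := hε
  haveI : IsProper S.hom := IsSmoothProjective.isProper_holds hf.isSmoothProjective_base
  haveI : IsProper f.left := hf.isSmoothProjectiveFamily.isProper
  have hcl : ∀ s : ComplexPoints S, IsClosedImmersion (fiberι f s ≫ ε).left := fun s ↦
    isClosedImmersion_fiberι_comp_left_of_isPreimmersion f ε s
  haveI := hcl t
  obtain ⟨D, c, hc⟩ := exists_kaehlerRationalDatum_eq_map (hf.isSmoothProjective_fiberOver t) (fiberι f t ≫ ε)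
  refine ⟨complexBetti.map ε 2 c, D, ?_, fun s ↦ ?_⟩
  · rw [hc, complexBetti.map_comp, CategoryTheory.comp_apply]
  · -- `c ≠ 0` spans `H²(ℙᴺ(ℂ); ℂ)`
    have hc0 : c ≠ 0 := by
      intro h0
      refine ne_zero_of_hasHardLefschetzProperty_fiberOver hf hd t (D.hLℂ (hf.isSmoothProjective_fiberOver t)) ?_
      rw [hc, h0, map_zero]
    obtain ⟨r₀, -, hr₀⟩ := exists_isRationalClass_forall_eq_smul_projectiveSpace N
    obtain ⟨z, hz⟩ := hr₀ c
    have hz0 : z ≠ 0 := by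
      rintro rfl
      exact hc0 (by rw [hz, zero_smul])
    have hgen : ∀ c' : complexBetti (projectiveSpace N ℂ) 2, ∃ w : ℂ, c' = w • c := fun c' ↦ by
      obtain ⟨z', hz'⟩ := hr₀ c'
      exact ⟨z' * z⁻¹, by rw [hz', hz, smul_smul, mul_assoc, inv_mul_cancel₀ hz0, mul_one]⟩
    haveI := hcl s
    have hHL := hasHardLefschetzProperty_map_of_forall_eq_smul (hf.isSmoothProjective_fiberOver s)
      (fiberι f s ≫ ε) hgen
    have e : complexBetti.map (fiberι f s) 2 (complexBetti.map ε 2 c) = complexBetti.map (fiberι f s ≫ ε) 2 c := by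
      rw [complexBetti.map_comp, CategoryTheory.comp_apply]
    rw [e]
    exact hHL

/-! ## §3 The primitive parts of a global class form a continuous section of the étalé space -/

/-- **Pull-back along a morphism intertwines the Lefschetz operators of a class and of its pull-back**
(`g^*(K ∪ x) = g^*K ∪ g^*x`), in the `AddMonoidHom`-family form consumed by §1. [cite: HatcherAT2002, §3.2 Prop. 3.10] -/
theorem semiconj_lefschetzOperator_map {X' X'' : Type} [TopologicalSpace X'] [TopologicalSpace X'']
    (g : C(X', X'')) (K : singularCohomology ℂ ℂ X'' 2) :
    ∀ (k l : ℕ) (h : 2 + k = l) (x : singularCohomology ℂ ℂ X'' k),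
      (singularCohomology.map ℂ ℂ g l).hom.toAddMonoidHom (lefschetzOperator K h x) =
        lefschetzOperator (singularCohomology.map ℂ ℂ g 2 K) h
          ((singularCohomology.map ℂ ℂ g k).hom.toAddMonoidHom x) := by
  intro k l h x
  change singularCohomology.map ℂ ℂ g l (lefschetzOperator K h x) =
    lefschetzOperator _ h (singularCohomology.map ℂ ℂ g k x)
  rw [Literature.Geometry.Kaehler.lefschetzOperator_apply, Literature.Geometry.Kaehler.lefschetzOperator_apply,
    cupProduct_map]

/-- **Flatness of the primitive parts.** For a compact pencil `f : 𝒳 ⟶ S` of abelian `d`-folds, a global class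
`K ∈ H²(𝒳(ℂ); ℂ)` whose restriction to every fibre has the hard Lefschetz property, a global class
`A ∈ Hⁱ(𝒳(ℂ); ℂ)` and a Lefschetz index `P = (a, t)`, the section `s ↦ (s, ξ_P^{(s)}(A|_{X_s}))` of the étalé
space `FiberClass f a` of `Rᵃ f_* ℂ` (primitive part for the class `K|_{X_s}`) is CONTINUOUS. Over an Ehresmann
tube `f⁻¹B ∋ X_{s₀}` on which every fibre restriction `r_s : H•(f⁻¹B(ℂ)) → H•(X_s(ℂ))` is bijective
(`isCohomologicallyLocallyTrivialOn_univ_of_isSmoothProjectiveFamily`, Voisin I Thm. 9.3), the composite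
`r_s ∘ r_{s₀}⁻¹` is additive, intertwines `L_{K|X_{s₀}}` and `L_{K|X_s}` (both restrictions are
multiplicative and carry `K|_{f⁻¹B}` to `K|_{X_·}`), hence commutes with the primitive parts (§1): the section
is the tube section of `r_{s₀}⁻¹(ξ_P^{(s₀)}(A|_{X_{s₀}}))`. [cite: VoisinHodgeI2002, §9.2.1 (with Thm. 9.3) and §6.2.3 Cor. 6.26]
[cite: VoisinHodgeII2003, §3.1.2] -/
theorem continuous_primitivePartSection {d : ℕ} {f : 𝒳 ⟶ S} (hf : IsCompactAbelianPencil f d)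
    (K : complexBetti 𝒳 2) (hK : ∀ s : ComplexPoints S, HasHardLefschetzProperty (complexBetti.map (fiberι f s) 2 K) d)
    {i : ℕ} (A : complexBetti 𝒳 i) (P : {p : ℕ × ℕ // p.1 + 2 * p.2 = i}) :
    Continuous fun s : ComplexPoints S ↦
      (⟨s, primitivePart (complexBetti.map (fiberι f s) 2 K) d (hK s) (hvan_fiberOver hf s) P
        (complexBetti.map (fiberι f s) i A)⟩ : FiberClass f P.1.1) := by
  haveI := hf.isSmoothProjective_base.smoothOfRelativeDimension
  have hU := isCohomologicallyLocallyTrivialOn_univ_of_isSmoothProjectiveFamily f 1 hf.isSmoothProjectiveFamily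
    (IsQuasiProjectiveOver.of_isProjectiveOver hf.isSmoothProjective_base.isProjectiveOver)
  refine continuous_iff_continuousAt.2 fun s₀ ↦ ?_
  obtain ⟨B, hBo, hs₀B, -, -, hbij⟩ := hU.exists_nhds_bijective (Set.mem_univ s₀) Set.univ univ_mem
  -- the transport `T_s = r_s ∘ r_{s₀}⁻¹ : H•(X_{s₀}) → H•(X_s)` for `s ∈ B`
  let rinv : ∀ j, complexBetti (fiberOver f s₀) j → singularCohomology ℂ ℂ (tubeOver f B) j :=
    fun j ↦ (Equiv.ofBijective _ (hbij j hs₀B)).symm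
  have hrinv : ∀ j (y : complexBetti (fiberOver f s₀) j), fiberRestrict f hs₀B j (rinv j y) = y :=
    fun j y ↦ Equiv.ofBijective_apply_symm_apply _ (hbij j hs₀B) y
  have hrinv' : ∀ j (ξ : singularCohomology ℂ ℂ (tubeOver f B) j), rinv j (fiberRestrict f hs₀B j ξ) = ξ :=
    fun j ξ ↦ Equiv.ofBijective_symm_apply_apply _ (hbij j hs₀B) ξ
  have hrinv_add : ∀ j (y y' : complexBetti (fiberOver f s₀) j), rinv j (y + y') = rinv j y + rinv j y' := by
    intro j y y'
    apply (hbij j hs₀B).1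
    rw [map_add, hrinv, hrinv, hrinv]
  -- the tube class restricting to the primitive parts
  set ζ : singularCohomology ℂ ℂ (tubeOver f B) P.1.1 :=
    rinv P.1.1 (primitivePart (complexBetti.map (fiberι f s₀) 2 K) d (hK s₀) (hvan_fiberOver hf s₀) P
      (complexBetti.map (fiberι f s₀) i A)) with hζ
  refine FiberClass.continuousAt_of_eventually_eq_tubeSection (Φ := fun s : ComplexPoints S ↦
      (⟨s, primitivePart (complexBetti.map (fiberι f s) 2 K) d (hK s) (hvan_fiberOver hf s) P
        (complexBetti.map (fiberι f s) i A)⟩ : FiberClass f P.1.1))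
    continuous_id.continuousAt hBo ζ ?_
  filter_upwards [hBo.mem_nhds hs₀B] with s hsB
  refine ⟨hsB, ?_⟩
  -- `T_s` as a family of additive maps
  let T : ∀ j, complexBetti (fiberOver f s₀) j →+ complexBetti (fiberOver f s) j := fun j ↦
    { toFun := fun y ↦ fiberRestrict f hsB j (rinv j y)
      map_zero' := by
        have h0 : rinv j 0 = 0 := (hbij j hs₀B).1 (by rw [hrinv, map_zero])
        rw [h0, map_zero]
      map_add' := fun y y' ↦ by rw [hrinv_add, map_add] }
  have hT_apply : ∀ j (ξ : singularCohomology ℂ ℂ (tubeOver f B) j),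
      T j (fiberRestrict f hs₀B j ξ) = fiberRestrict f hsB j ξ := fun j ξ ↦ by
    change fiberRestrict f hsB j (rinv j (fiberRestrict f hs₀B j ξ)) = _
    rw [hrinv']
  -- restrictions of global classes: `T_s (G|X_{s₀}) = G|X_s`
  have hT_global : ∀ j (G : complexBetti 𝒳 j),
      T j (complexBetti.map (fiberι f s₀) j G) = complexBetti.map (fiberι f s) j G := fun j G ↦ by
    rw [← fiberRestrict_restrictTube_apply f hs₀B j G, hT_apply, fiberRestrict_restrictTube_apply]
  -- `T_s` intertwines the Lefschetz operators of `K|X_{s₀}` and `K|X_s`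
  have hT : ∀ (k l : ℕ) (h : 2 + k = l) (x : complexBetti (fiberOver f s₀) k),
      T l (lefschetzOperator (complexBetti.map (fiberι f s₀) 2 K) h x) =
        lefschetzOperator (complexBetti.map (fiberι f s) 2 K) h (T k x) := by
    intro k l h x
    obtain ⟨ξ, rfl⟩ := (hbij k hs₀B).2 x
    have e1 : cupProduct h (fiberRestrict f hs₀B 2 (restrictTube f B 2 K)) (fiberRestrict f hs₀B k ξ) =
        fiberRestrict f hs₀B l (cupProduct h (restrictTube f B 2 K) ξ) :=
      (cupProduct_map (fiberToTube f hs₀B) h _ _).symm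
    have e2 : cupProduct h (fiberRestrict f hsB 2 (restrictTube f B 2 K)) (fiberRestrict f hsB k ξ) =
        fiberRestrict f hsB l (cupProduct h (restrictTube f B 2 K) ξ) :=
      (cupProduct_map (fiberToTube f hsB) h _ _).symm
    rw [hT_apply k ξ, Literature.Geometry.Kaehler.lefschetzOperator_apply,
      Literature.Geometry.Kaehler.lefschetzOperator_apply, ← fiberRestrict_restrictTube_apply f hs₀B 2 K,
      ← fiberRestrict_restrictTube_apply f hsB 2 K, e1, e2, hT_apply]
  -- conclusion: the section at `s` is the tube section of `ζ`
  change (⟨s, _⟩ : FiberClass f P.1.1) = ⟨s, fiberRestrict f hsB P.1.1 ζ⟩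
  rw [FiberClass.mk_eq_mk_iff, hζ]
  change _ = T P.1.1 (primitivePart (complexBetti.map (fiberι f s₀) 2 K) d (hK s₀) (hvan_fiberOver hf s₀) P
    (complexBetti.map (fiberι f s₀) i A))
  rw [map_primitivePart_of_semiconj (hK s₀) (hvan_fiberOver hf s₀) (hK s) (hvan_fiberOver hf s) T hT P,
    hT_global]

/-! ## §4 The image of restriction is stable under the primitive parts (from the named fact) -/

/-- **Stability of `Im j_t^*` under the primitive projections, from Deligne 1968 / Voisin II Thm. 4.18.**
Granted the named fact `deligne1968_invariantClass_fromTotalSpace` (a continuous section of the étalé space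
`FiberClass f a` takes, at each point, the value of the restriction of a GLOBAL class), for every compact
pencil `f : 𝒳 ⟶ S` of abelian `d`-folds, every global `K` with the hard Lefschetz property on all fibres, every
global `A ∈ Hⁱ(𝒳(ℂ); ℂ)`, every Lefschetz index `P = (a, t)` and every `t₀`: the primitive part
`ξ_P^{(t₀)}(A|_{X_{t₀}})` is again the restriction of a global class `B ∈ Hᵃ(𝒳(ℂ); ℂ)`. The hypotheses of the
fact hold: `f` is a smooth projective family, `𝒳` and `S` are projective (hence quasi-projective), `S` is
smooth. [cite: VoisinHodgeII2003, §4.3.1 Thm. 4.18 (with Lemma 4.17)] [cite: Deligne1968, Prop. 2.1 and (2.6.3)]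
[cite: DeligneHodgeII1971, Thm. 4.1.1] -/
theorem exists_primitivePart_map_fiberι_eq (h418 : deligne1968_invariantClass_fromTotalSpace)
    {d : ℕ} {f : 𝒳 ⟶ S} (hf : IsCompactAbelianPencil f d)
    (K : complexBetti 𝒳 2) (hK : ∀ s : ComplexPoints S, HasHardLefschetzProperty (complexBetti.map (fiberι f s) 2 K) d)
    {i : ℕ} (A : complexBetti 𝒳 i) (P : {p : ℕ × ℕ // p.1 + 2 * p.2 = i}) (t₀ : ComplexPoints S) :
    ∃ B : complexBetti 𝒳 P.1.1,
      primitivePart (complexBetti.map (fiberι f t₀) 2 K) d (hK t₀) (hvan_fiberOver hf t₀) P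
        (complexBetti.map (fiberι f t₀) i A) = complexBetti.map (fiberι f t₀) P.1.1 B := by
  obtain ⟨B, hB⟩ := h418 𝒳 S f d hf.isSmoothProjectiveFamily
    (IsQuasiProjectiveOver.of_isProjectiveOver hf.isSmoothProjective_total.isProjectiveOver)
    (IsQuasiProjectiveOver.of_isProjectiveOver hf.isSmoothProjective_base.isProjectiveOver)
    (Andre1996.compactPencil_smooth_base hf) P.1.1 _ (continuous_primitivePartSection hf K hK A P)
    (fun _ ↦ rfl) t₀
  exact ⟨B, (FiberClass.mk_eq_mk_iff _ _).1 hB⟩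

end Summit.HodgeConjecture.HodgeConjecture.Ring2.AbelianAll

end
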